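import Summits.SmoothPoincare4.SmoothPoincare4.Theses.IsotropicCorkBracketing
import Summits.SmoothPoincare4.SmoothPoincare4.Theorems.IsotropicCorkBracketingRoundSideGivesBracketing
import Literature.Geometry.Riemannian.NeumannIsotropicFormPos
import Literature.Geometry.Lorentzian.Isometry

/-!
# Census sketch — crux `CorkIsotropicBracketing` (stmt-SmoothPoincare4-11210), RESTATED re-audit

Typed companions of `STRATEGY-CENSUS.md` (crux-strategist seat cstrat-stmt-SmoothPoincare4-11210-r1).
Nothing here is a route item; the file records, in Lean, two of the decompositions examined and
why they do not qualify for the BC2 redirect exemption: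

* `D1`: the one-sided strengthening `CorkSideIsotropicFillIn` (item 11211) ALONE already yields
  the crux by the landed theorem `roundSideGivesBracketing_proof` — an honest reduction with
  `k = 1` piece, not a decomposition (`corkIsotropicBracketing_of_corkSide`).
* `D3`: the route header's own "two-layer plan" (symmetric germ / isometric regluing), typed as
  `IsometricTwistExact` (S⁴ carries a metric, Neumann-isotropic-positive on both pieces of the
  splitting, to whose pieces the pieces of the twisted gluing `P` are isometric — equality of the
  pulled-back bilinear forms on the abstract pieces `C`, `W`) and the transfer lemma
  `IsometryTransfersNeumannPos`; the assembly `corkIsotropicBracketing_of_isometricTwist` is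
  binder threading only (trivial seam, violates (b)), and `IsometricTwistExact` is false for every
  `τ` preserving no Riemannian metric on `Z_C` (census §Decomposition D3).
-/

namespace Summit.SmoothPoincare4.SmoothPoincare4.Cruxes.CorkIsotropicBracketing.Census

open scoped Manifold ContDiff Topology
open Summit.SmoothPoincare4.SmoothPoincare4.Theses.IsotropicCorkBracketing

/-- D1 (k = 1): the existing one-sided child already implies the crux (landed glue). -/
theorem corkIsotropicBracketing_of_corkSide : CorkSideIsotropicFillIn → CorkIsotropicBracketing :=
  Summit.SmoothPoincare4.SmoothPoincare4.Theorems.roundSideGivesBracketing_proof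

/-- D3a — ISOMETRIC TWIST (exact `τ`): for every splitting `S⁴ = C ∪_φ W` (explicit `kC`, `kW`),
every `τ` and every `P = C ∪_(φ∘τ) W` (explicit `jC`, `jW`) there is a Riemannian `g` on `S⁴`,
Neumann-isotropic-positive on `kC(C)` and on `kW(W)`, and a Riemannian `G` on `P` whose pieces
are isometric to those of `g`: `jC^* G = kC^* g` on `C` and `jW^* G = kW^* g` on `W`. -/
def IsometricTwistExact : Prop :=
  ∀ (C : Type) [TopologicalSpace C] [T2Space C] [SecondCountableTopology C] [ChartedSpace (EuclideanHalfSpace 4) C] [IsManifold (𝓡∂ 4) ∞ C] [CompactSpace C] [ContractibleSpace C] (ZC : Type) [TopologicalSpace ZC] [ChartedSpace (EuclideanSpace ℝ (Fin 3)) ZC] [IsManifold (𝓡 3) ∞ ZC] (ιC : ZC → C) (_ : Manifold.IsSmoothEmbedding (𝓡 3) (𝓡∂ 4) ∞ ιC) (_ : Set.range ιC = (𝓡∂ 4).boundary C) (W : Type) [TopologicalSpace W] [T2Space W] [SecondCountableTopology W] [ChartedSpace (EuclideanHalfSpace 4) W] [IsManifold (𝓡∂ 4) ∞ W] [CompactSpace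 W] (ZW : Type) [TopologicalSpace ZW] [ChartedSpace (EuclideanSpace ℝ (Fin 3)) ZW] [IsManifold (𝓡 3) ∞ ZW] (ιW : ZW → W) (_ : Manifold.IsSmoothEmbedding (𝓡 3) (𝓡∂ 4) ∞ ιW) (_ : Set.range ιW = (𝓡∂ 4).boundary W) (φ : ZC ≃ₘ⟮𝓡 3, 𝓡 3⟯ ZW) (τ : ZC ≃ₘ⟮𝓡 3, 𝓡 3⟯ ZC) (kC : C → Metric.sphere (0 : EuclideanSpace ℝ (Fin 5)) 1) (kW : W → Metric.sphere (0 : EuclideanSpace ℝ (Fin 5)) 1), Manifold.IsSmoothEmbedding (𝓡∂ 4) (𝓡 4) ∞ kC → Manifold.IsSmoothEmbedding (𝓡∂ 4) (𝓡 4) ∞ kW → Set.range kC ∪ Set.range kW = Set.univ → (∀ a b, kC a = kW b ↔ ∃ z, a = ιC z ∧ b = ιW (φ z)) → ∀ (P : Type) [TopologicalSpace P] [T2Space P] [SecondCountableTopology P] [ChartedSpace (EuclideanSpace ℝ (Fin 4)) P] [IsManifold (𝓡 4) ∞ P] [CompactSpace P] [MeasurableSpace P] [BorelSpace P] (jC :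 C → P) (jW : W → P), Manifold.IsSmoothEmbedding (𝓡∂ 4) (𝓡 4) ∞ jC → Manifold.IsSmoothEmbedding (𝓡∂ 4) (𝓡 4) ∞ jW → Set.range jC ∪ Set.range jW = Set.univ → (∀ a b, jC a = jW b ↔ ∃ z, a = ιC z ∧ b = ιW ((τ.trans φ) z)) → ∃ g : Literature.Geometry.Lorentzian.PseudoRiemannianMetric (𝓡 4) ∞ (EuclideanSpace ℝ (Fin 4)) (TangentSpace (𝓡 4) : (Metric.sphere (0 : EuclideanSpace ℝ (Fin 5)) 1) → Type _), ∃ hg : g.IsRiemannian, ∃ _ : g.HasLeviCivita, Literature.Geometry.Riemannian.NeumannIsotropicFormPos g hg (Set.range kC) ∧ Literature.Geometry.Riemannian.NeumannIsotropicFormPos g hg (Set.range kW) ∧ ∃ G : Literature.Geometry.Lorentzian.PseudoRiemannianMetric (𝓡 4) ∞ (EuclideanSpace ℝ (Fin 4)) (TangentSpace (𝓡 4) : P → Type _), ∃ hG : G.IsRiemannian, ∃ _ : G.HasLeviCivita, (∀ c, Literature.Geometry.Lorentzian.pullbackBilin (I := 𝓡 4) (I' := 𝓡∂ 4) jC G.val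 c = Literature.Geometry.Lorentzian.pullbackBilin (I := 𝓡 4) (I' := 𝓡∂ 4) kC g.val c) ∧ (∀ w, Literature.Geometry.Lorentzian.pullbackBilin (I := 𝓡 4) (I' := 𝓡∂ 4) jW G.val w = Literature.Geometry.Lorentzian.pullbackBilin (I := 𝓡 4) (I' := 𝓡∂ 4) kW g.val w)

/-- D3b — ISOMETRY TRANSFERS NEUMANN POSITIVITY: if a compact piece `A` is embedded in two closed
Riemannian 4-manifolds `(M, g)`, `(P, G)` by `k`, `j` with `j^* G = k^* g`, then Neumann
positivity of the isotropic form of `g` on `k(A)` implies that of `G` on `j(A)` (true: transport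
of `gradSq`, of the isotropic curvatures and of the Riemannian measure along the isometry of the
pieces, plus a `C¹` Whitney extension of test functions from the closed piece; not in the tree). -/
def IsometryTransfersNeumannPos : Prop :=
  ∀ (A : Type) [TopologicalSpace A] [ChartedSpace (EuclideanHalfSpace 4) A] [IsManifold (𝓡∂ 4) ∞ A] [CompactSpace A] (M : Type) [TopologicalSpace M] [T2Space M] [SecondCountableTopology M] [ChartedSpace (EuclideanSpace ℝ (Fin 4)) M] [IsManifold (𝓡 4) ∞ M] [CompactSpace M] [MeasurableSpace M] [BorelSpace M] (P : Type) [TopologicalSpace P] [T2Space P] [SecondCountableTopology P] [ChartedSpace (EuclideanSpace ℝ (Fin 4)) P] [IsManifold (𝓡 4) ∞ P] [CompactSpace P] [MeasurableSpace P] [BorelSpace P] (k : A → M) (j : A → P), Manifold.IsSmoothEmbedding (𝓡∂ 4) (𝓡 4) ∞ k → Manifold.IsSmoothEmbedding (𝓡∂ 4) (𝓡 4) ∞ j → ∀ (g : Literature.Geometry.Lorentzian.PseudoRiemannianMetric (𝓡 4) ∞ (EuclideanSpace ℝ (Fin 4)) (TangentSpace (𝓡 4) : M → Type _)) (hg : g.IsRiemannian)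 [g.HasLeviCivita] (G : Literature.Geometry.Lorentzian.PseudoRiemannianMetric (𝓡 4) ∞ (EuclideanSpace ℝ (Fin 4)) (TangentSpace (𝓡 4) : P → Type _)) (hG : G.IsRiemannian) [G.HasLeviCivita], (∀ a, Literature.Geometry.Lorentzian.pullbackBilin (I := 𝓡 4) (I' := 𝓡∂ 4) j G.val a = Literature.Geometry.Lorentzian.pullbackBilin (I := 𝓡 4) (I' := 𝓡∂ 4) k g.val a) → Literature.Geometry.Riemannian.NeumannIsotropicFormPos g hg (Set.range k) → Literature.Geometry.Riemannian.NeumannIsotropicFormPos G hG (Set.range j)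

/-- D3 assembly: `IsometricTwistExact ∧ IsometryTransfersNeumannPos → CorkIsotropicBracketing`.
The proof is binder threading only — the seam is trivial (BC2 (b) fails). -/
theorem corkIsotropicBracketing_of_isometricTwist
    (h₁ : IsometricTwistExact) (h₂ : IsometryTransfersNeumannPos) : CorkIsotropicBracketing := by
  intro C _ _ _ _ _ _ _ ZC _ _ _ ιC hιC hιC' W _ _ _ _ _ _ ZW _ _ _ ιW hιW hιW' φ τ hS4
    P _ _ _ _ _ _ _ _ jC jW hjC hjW hcov hseam
  obtain ⟨kC, kW, hkC, hkW, hkcov, hkseam⟩ := hS4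
  obtain ⟨g, hg, hgLC, hgC, hgW, G, hG, hGLC, hpC, hpW⟩ :=
    h₁ C ZC ιC hιC hιC' W ZW ιW hιW hιW' φ τ kC kW hkC hkW hkcov hkseam P jC jW hjC hjW hcov hseam
  haveI := hgLC
  haveI := hGLC
  have hC := h₂ C _ P kC jC hkC hjC g hg G hG hpC hgC
  have hW := h₂ W _ P kW jW hkW hjW g hg G hG hpW hgW
  exact ⟨G, hG, hGLC, hC, hW⟩

end Summit.SmoothPoincare4.SmoothPoincare4.Cruxes.CorkIsotropicBracketing.Census
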